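import Summits.ABC.ABC.Theses.RationalCuspPencil
import HarnessLib

/-!
# Route `RationalCuspPencil` — item `Assembly` (stmt-ABC-24553)

`Assembly := PencilFourBound → SixTorsionDictionary → SixTorsionPayoff → SixTorsionResidual → ABC`
is literally the planner's deciding theorem `closes` of the route file (pure logic:
`h₄ (h₃ h₁ h₂)`). Cell `abc-harv`, seat pr-4.

HONESTY. Content-free bookkeeping. The mathematical content of the line is the class theorem
`SixTorsionClassEpsShape` (stmt-ABC-24548, closed by `sixTorsionClassEpsShape_proof`: ε-shape 1/4
on Kubert's ℤ/6 family) and the general pencil engine `pencil_log_height_le_rad_rpow`; the last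
hypothesis `SixTorsionResidual` is the DECLARED residual of summit strength (= abc off the class),
not claimed and never staffed. Landing this implication proves nothing about abc, A-PS
(«NOT abc — POLY-SZPIRO(E)») or A1′; it moves no rung of LADDER-ABC.
-/

-- `Summit.<Summit>.<Problem>` is the mandated summit-side namespace (CONVENTIONS §2); for the
-- single-conjunct summit `ABC` the two coincide, so the duplicate `ABC.ABC` is deliberate.
set_option linter.dupNamespace false

namespace Summit.ABC.ABC.Theorems

/-- **Closes stmt-ABC-24553** (item `Assembly` of route `RationalCuspPencil`):
`PencilFourBound → SixTorsionDictionary → SixTorsionPayoff → SixTorsionResidual → ABC`, by the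
route's own `closes` (pure logic). Content-free; NOT abc, NOT A-PS, NOT A1′ — the residual
hypothesis is declared, not discharged. [folklore] -/
theorem rationalCuspPencil_assembly_proof :
    Summit.ABC.ABC.Theses.RationalCuspPencil.Assembly :=
  fun h₁ h₂ h₃ h₄ => Summit.ABC.ABC.Theses.RationalCuspPencil.closes h₁ h₂ h₃ h₄

end Summit.ABC.ABC.Theorems
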